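import Literature.NumberTheory.LFunctions.HalfIsolatedZeroLemma15
import Literature.NumberTheory.LFunctions.HalfIsolatedZeroExplicit
import Literature.Analysis.Complex.MaynardPrattPowerSumProofs
import HarnessLib

/-!
# Half-isolated zeros (Maynard–Pratt 2024), VII: Proposition 16 from Lemma 11

Topic `Literature/NumberTheory/LFunctions`. Everything in this file is PROVED (no definition, no
named fact). Last file of the in-tree proof of

* J. Maynard, K. Pratt, *Half-isolated zeros and zero-density estimates*, IMRN 2024 =
  arXiv:2206.11729, **Proposition 16** (short zero-detecting polynomial for `Y`-half-isolated
  zeros, p. 10) = the named fact `Literature.NumberTheory.LFunctions.MaynardPratt2024_prop16` of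
  `HalfIsolatedZero.lean`,

from the named fact `Literature.Analysis.Complex.MaynardPratt2024_lemma11` (Lemma 11), which the
tree discharges in `Literature/Analysis/Complex/MaynardPrattPowerSumProofs.lean`
(`MaynardPratt2024_lemma11_holds`), so that the DISCHARGE `MaynardPratt2024_prop16_holds` at the end
of this file is unconditional:

* `Literature.NumberTheory.LFunctions.MaynardPratt2024_prop16_of_lemma11` — **Proposition 16 from
  Lemma 11**, following the printed proof (p. 10–11): the grid
  `𝒰 = {e^{jℓ}} ∩ [exp((log log T)³), T²]`, `ℓ = log(1 + (log T)^{−150})`, of cardinality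
  `≤ (log T)^{152}` (`grid_card_le`); the explicit formula for `S_U(ρ₀) = Σ Λ(n) w₀(n/U) n^{−ρ₀}` at
  the zero `ρ₀` (`HalfIsolatedZeroExplicit.lean`); the pole term `U^{1−ρ₀}W₀(1−ρ₀)` and the trivial
  zeros (`norm_pole_term_le`, `norm_tsum_trivial_le`); the zeros outside
  `𝒮_≈ = {|ρ−ρ₀| ≤ (log T)², |β−β₀| ≤ 1/(10 log Y), γ ≥ γ₀}` (`sum_excluded_zeros_le`: the far
  zeros `|ρ−ρ₀| > (log T)²` by the sub-exponential Mellin decay of `w₀` — the only place where the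
  vendored restriction `log Y ≤ (log T)/2` enters, through `|U^{ρ−ρ₀}| ≤ U^{1/2} ≤ T^{1/2}` — and the
  near ones, which half-isolation pushes to `β ≤ β₀ − (log log T)²/log Y`); and Lemma 15
  (`HalfIsolatedZeroLemma15.lean`) for the main sum. The absolute constant is `c = 1`; the threshold
  `T₀` is explicit in the absolute constants of the previous files (`far_small`, `pole_small`,
  `near_small`, `triv_small`).

* `Literature.NumberTheory.LFunctions.MaynardPratt2024_prop16_holds` — **the discharge** of the
  named fact, `MaynardPratt2024_prop16_of_lemma11 MaynardPratt2024_lemma11_holds`.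

## References

* J. Maynard, K. Pratt, IMRN 2024:19, 12978–13014 = arXiv:2206.11729, Proposition 16 and its
  proof (p. 10–11). (`MaynardPratt2024`)
-/

noncomputable section

open Complex Real Set Filter Metric MeasureTheory
open scoped Topology Nat

namespace Literature.NumberTheory.LFunctions

namespace MaynardPratt

/-! ## Proposition 16: the error terms -/

/-- `C_b ≥ 0` from the bound at `s = 0`. [folklore] -/
theorem const_nonneg_of_W0_bound {Cb : ℝ}
    (hCb : ∀ s : ℂ, ‖mellin (fun x : ℝ ↦ ((w0 x : ℝ) : ℂ)) s‖ ≤ Cb * (2 : ℝ) ^ |s.re| / (1 + s.im ^ 2)) :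
    0 ≤ Cb := by
  have h0 := hCb 0
  simp only [zero_re, abs_zero, Real.rpow_zero, mul_one, zero_im] at h0
  norm_num at h0
  exact (norm_nonneg _).trans h0

/-- **The pole term** `U^{1−ρ₀}W₀(1−ρ₀)` (p. 10: "`≪ T^{−2}`"): for `U ≥ 1`, `1/2 ≤ β₀ ≤ 1`,
`|U^{1−ρ₀}W₀(1−ρ₀)| ≤ 2C_b U^{1/2}/(1 + γ₀²)`. [cite: MaynardPratt2024, Proposition 16 (proof)] -/
theorem norm_pole_term_le {Cb : ℝ}
    (hCb : ∀ s : ℂ, ‖mellin (fun x : ℝ ↦ ((w0 x : ℝ) : ℂ)) s‖ ≤ Cb * (2 : ℝ) ^ |s.re| / (1 + s.im ^ 2))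
    {U : ℝ} (hU : 1 ≤ U) {ρ : ℂ} (h1 : 1 / 2 ≤ ρ.re) (h2 : ρ.re ≤ 1) :
    ‖(U : ℂ) ^ (1 - ρ) * mellin (fun x : ℝ ↦ ((w0 x : ℝ) : ℂ)) (1 - ρ)‖ ≤
      2 * Cb * U ^ (1 / 2 : ℝ) / (1 + ρ.im ^ 2) := by
  have hCb0 := const_nonneg_of_W0_bound hCb
  rw [norm_mul, Complex.norm_cpow_eq_rpow_re_of_pos (by linarith)]
  have hre : (1 - ρ).re = 1 - ρ.re := by simp
  have him : (1 - ρ).im = -ρ.im := by simp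
  have hU1 : U ^ (1 - ρ).re ≤ U ^ (1 / 2 : ℝ) := Real.rpow_le_rpow_of_exponent_le hU (by rw [hre]; linarith)
  have hW := hCb (1 - ρ)
  rw [hre, him, neg_sq, abs_of_nonneg (by linarith)] at hW
  have h22 : (2 : ℝ) ^ (1 - ρ.re) ≤ 2 := by
    calc (2 : ℝ) ^ (1 - ρ.re) ≤ 2 ^ (1 : ℝ) := Real.rpow_le_rpow_of_exponent_le one_le_two (by linarith)
      _ = 2 := Real.rpow_one 2
  have hW2 : ‖mellin (fun x : ℝ ↦ ((w0 x : ℝ) : ℂ)) (1 - ρ)‖ ≤ Cb * 2 / (1 + ρ.im ^ 2) :=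
    hW.trans (div_le_div_of_nonneg_right (mul_le_mul_of_nonneg_left h22 hCb0) (by positivity))
  calc U ^ (1 - ρ).re * ‖mellin (fun x : ℝ ↦ ((w0 x : ℝ) : ℂ)) (1 - ρ)‖
      ≤ U ^ (1 / 2 : ℝ) * (Cb * 2 / (1 + ρ.im ^ 2)) :=
        mul_le_mul hU1 hW2 (norm_nonneg _) (Real.rpow_nonneg (by linarith) _)
    _ = _ := by ring

/-- **The trivial-zero terms** (the paper's `O(U⁻¹)` from the line `Re s = −2`): for `U ≥ 3` and
`Re ρ₀ ≥ 0`, `|Σ_{k≥1} U^{−ρ₀−2k}W₀(−ρ₀−2k)| ≤ 24/U²` (`|W₀(s)| ≤ 3·2^{|σ|}` and a geometric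
series). [cite: MaynardPratt2024, Proposition 16 (proof)] -/
theorem norm_tsum_trivial_le {U : ℝ} (hU : 3 ≤ U) {ρ : ℂ} (hρ : 0 ≤ ρ.re) :
    ‖∑' k : ℕ, (U : ℂ) ^ (-(ρ + 2 * ((k : ℂ) + 1))) *
        mellin (fun x : ℝ ↦ ((w0 x : ℝ) : ℂ)) (-(ρ + 2 * ((k : ℂ) + 1)))‖ ≤ 24 / U ^ 2 := by
  have hU0 : 0 < U := by linarith
  set r : ℝ := (2 / U) ^ 2 with hr
  have hq0 : 0 ≤ 2 / U := by positivity
  have hq1 : 2 / U ≤ 1 := by rw [div_le_one hU0]; linarith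
  have hr0 : 0 ≤ r := by positivity
  have hr1 : r ≤ 1 / 2 := by
    have : 2 / U ≤ 2 / 3 := div_le_div_of_nonneg_left (by norm_num) (by norm_num) hU
    rw [hr]; nlinarith
  have hterm : ∀ k : ℕ, ‖(U : ℂ) ^ (-(ρ + 2 * ((k : ℂ) + 1))) *
      mellin (fun x : ℝ ↦ ((w0 x : ℝ) : ℂ)) (-(ρ + 2 * ((k : ℂ) + 1)))‖ ≤ 3 * r * r ^ k := by
    intro k
    have hk : (0 : ℝ) ≤ k := k.cast_nonneg
    set x : ℝ := ρ.re + 2 * k + 2 with hx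
    have hx0 : 0 ≤ x := by positivity
    have hre : (-(ρ + 2 * ((k : ℂ) + 1))).re = -x := by
      rw [hx]; simp; ring
    rw [norm_mul, Complex.norm_cpow_eq_rpow_re_of_pos hU0, hre]
    have hW := norm_W0_le (-(ρ + 2 * ((k : ℂ) + 1)))
    rw [hre, abs_neg, abs_of_nonneg hx0] at hW
    calc U ^ (-x) * ‖mellin (fun x : ℝ ↦ ((w0 x : ℝ) : ℂ)) (-(ρ + 2 * ((k : ℂ) + 1)))‖
        ≤ U ^ (-x) * (3 * 2 ^ x) := by gcongr
      _ = 3 * (2 / U) ^ x := by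
          rw [Real.div_rpow (by norm_num) hU0.le, Real.rpow_neg hU0.le]; ring
      _ ≤ 3 * (2 / U) ^ (((2 * k + 2 : ℕ)) : ℝ) :=
          mul_le_mul_of_nonneg_left (Real.rpow_le_rpow_of_exponent_ge (by positivity) hq1
            (by push_cast; linarith)) (by norm_num)
      _ = 3 * r * r ^ k := by
          rw [Real.rpow_natCast, hr, ← pow_mul, pow_succ]; ring
  have hgeom : HasSum (fun k : ℕ ↦ 3 * r * r ^ k) (3 * r * (1 - r)⁻¹) :=
    (hasSum_geometric_of_lt_one hr0 (by linarith)).mul_left (3 * r)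
  calc ‖∑' k : ℕ, (U : ℂ) ^ (-(ρ + 2 * ((k : ℂ) + 1))) *
        mellin (fun x : ℝ ↦ ((w0 x : ℝ) : ℂ)) (-(ρ + 2 * ((k : ℂ) + 1)))‖
      ≤ 3 * r * (1 - r)⁻¹ := tsum_of_norm_bounded hgeom hterm
    _ ≤ 3 * r * 2 := by
        gcongr
        rw [inv_le_comm₀ (by linarith) (by norm_num)]; linarith
    _ = 24 / U ^ 2 := by rw [hr]; field_simp; ring

/-- `‖(eᵘ)^z · w‖`-bookkeeping: `|m · ((eᵘ)^z W)| = m e^{u Re z} |W|` for `m ≥ 0`. [folklore] -/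
theorem norm_zeroTerm_eq {m : ℤ} (hm : 0 ≤ m) (u : ℝ) (z W : ℂ) :
    ‖(m : ℂ) * (((Real.exp u : ℝ) : ℂ) ^ z * W)‖ = m * (Real.exp (u * z.re) * ‖W‖) := by
  rw [norm_mul, norm_mul, Complex.norm_intCast, Complex.norm_cpow_eq_rpow_re_of_pos (Real.exp_pos u),
    ← Real.exp_mul]
  congr 1
  exact_mod_cast abs_of_nonneg hm

open ZetaZeros.riemannZetaNontrivialZeros in
/-- **The discarded zeros** (proof of Proposition 16, p. 10): for a `Y`-half-isolated zero
`ρ₀ = β₀ + iγ₀` with `β₀ ≥ 1/2`, `γ₀ ∈ [T, 2T]`, and `U = eᵘ` with `log Y ≤ u ≤ log T`, the zeros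
outside the set `𝒮_≈ = {|ρ−ρ₀| ≤ (log T)², |β−β₀| ≤ 1/(10 log Y), γ ≥ γ₀}` contribute to
`Σ_ρ m(ρ)U^{ρ−ρ₀}W₀(ρ−ρ₀)` at most
`4C_cC₂e^{4/5} L⁵ e^{L/2} e^{−(4/5)L} + 4C_bC₁ L e^{−(log L)²}` (`L = log T`): the FAR zeros
`|ρ−ρ₀| > L²` by `|U^{ρ−ρ₀}| ≤ U^{1/2} ≤ e^{L/2}` and the sub-exponential Mellin decay
(`exists_sum_order_mul_exp_neg_sqrt_le` with `M = L² − 1`, `√M ≥ L − 1`), the NEAR ones, which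
by half-isolation have `β ≤ β₀ − (log log T)²/log Y`, by `|U^{ρ−ρ₀}| ≤ e^{−(log L)²}` and
`Σ m(ρ)/(1+(γ−γ₀)²) ≪ log T`. [cite: MaynardPratt2024, Proposition 16 (proof)] -/
theorem sum_excluded_zeros_le {Cb Cc C₁ C₂ : ℝ}
    (hCb : ∀ s : ℂ, ‖mellin (fun x : ℝ ↦ ((w0 x : ℝ) : ℂ)) s‖ ≤ Cb * (2 : ℝ) ^ |s.re| / (1 + s.im ^ 2))
    (hCc : ∀ s : ℂ, ‖mellin (fun x : ℝ ↦ ((w0 x : ℝ) : ℂ)) s‖ ≤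
      Cc * (2 : ℝ) ^ |s.re| * Real.exp (-(4 / 5 * √|s.im|)))
    (hC₁ : ∀ (t : ℝ) (F : Finset ℂ), (∀ ρ ∈ F, ρ ∈ RHWave0.riemannZetaNontrivialZeros) →
      ∑ ρ ∈ F, (riemannZetaZeroOrder ρ : ℝ) / (1 + (ρ.im - t) ^ 2) ≤ C₁ * Real.log (|t| + 2))
    (hC₂ : ∀ (t M : ℝ), 25 ≤ M → ∀ F : Finset ℂ,
      (∀ ρ ∈ F, ρ ∈ RHWave0.riemannZetaNontrivialZeros ∧ M ≤ |ρ.im - t|) →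
      ∑ ρ ∈ F, (riemannZetaZeroOrder ρ : ℝ) * Real.exp (-(4 / 5 * √|ρ.im - t|)) ≤
        C₂ * M ^ 2 * Real.exp (-(4 / 5 * √M)) * Real.log (|t| + 2))
    {T Y : ℝ} {ρ : ℂ} (hiso : YHalfIsolatedZero Y ρ) (hL6 : 6 ≤ Real.log T)
    (hβ : 1 / 2 ≤ ρ.re) (hγ1 : T ≤ ρ.im) (hγ2 : ρ.im ≤ 2 * T)
    {u : ℝ} (hu1 : Real.log Y ≤ u) (hu2 : u ≤ Real.log T) (hA0 : 0 < Real.log Y)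
    (F : Finset ℂ) (hF : ∀ ρ' ∈ F, ρ' ∈ RHWave0.riemannZetaNontrivialZeros ∧
      ¬ (‖ρ' - ρ‖ ≤ Real.log T ^ 2 ∧ |ρ'.re - ρ.re| ≤ 1 / (10 * Real.log Y) ∧ ρ.im ≤ ρ'.im)) :
    ∑ ρ' ∈ F, ‖(riemannZetaZeroOrder ρ' : ℂ) *
        (((Real.exp u : ℝ) : ℂ) ^ (ρ' - ρ) * mellin (fun x : ℝ ↦ ((w0 x : ℝ) : ℂ)) (ρ' - ρ))‖ ≤
      4 * Cc * C₂ * Real.exp (4 / 5) * Real.log T ^ 5 * Real.exp (Real.log T / 2) *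
          Real.exp (-(4 / 5 * Real.log T)) +
        4 * Cb * C₁ * Real.log T * Real.exp (-(Real.log (Real.log T) ^ 2)) := by
  classical
  set L := Real.log T with hL
  set A := Real.log Y with hA
  have hCb0 := const_nonneg_of_W0_bound hCb
  have hCc0 : 0 ≤ Cc := by
    have h0 := hCc 0
    simp only [zero_re, abs_zero, Real.rpow_zero, mul_one, zero_im, Real.sqrt_zero, mul_zero,
      neg_zero, Real.exp_zero] at h0
    exact (norm_nonneg _).trans h0
  have hT0 : 0 < T := by
    have hTnn : 0 ≤ T := by linarith
    rcases hTnn.lt_or_eq with h | h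
    · exact h
    · exfalso
      have : L = 0 := by rw [hL, ← h, Real.log_zero]
      linarith
  have hTe : Real.exp 1 ≤ T := by
    rw [← Real.le_log_iff_exp_le hT0]; linarith
  have hT4 : 4 ≤ T := by
    by_contra h
    push Not at h
    have h3 : L < Real.log 4 := Real.log_lt_log hT0 h
    have h4 : Real.log 4 ≤ 4 := by
      rw [Real.log_le_iff_le_exp (by norm_num)]; linarith [Real.add_one_le_exp (4 : ℝ)]
    linarith
  have hL1 : 1 ≤ L := by linarith
  have hu0 : 0 ≤ u := le_trans hA0.le hu1
  have hm : ∀ ρ' ∈ F, (0 : ℤ) ≤ riemannZetaZeroOrder ρ' := fun ρ' h ↦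
    le_trans zero_le_one (one_le_order (hF ρ' h).1)
  have hm' : ∀ ρ' ∈ F, (0 : ℝ) ≤ (riemannZetaZeroOrder ρ' : ℝ) := fun ρ' h ↦ by
    exact_mod_cast hm ρ' h
  have hρZ : ρ ∈ RHWave0.riemannZetaNontrivialZeros := mem_of_re_pos hiso.zero (by linarith)
  have hβ1 : ρ.re < 1 := re_lt_one hρZ
  have hre1 : ∀ ρ' ∈ F, |ρ'.re - ρ.re| ≤ 1 := fun ρ' h ↦ by
    have h1 := re_pos (hF ρ' h).1
    have h2 := re_lt_one (hF ρ' h).1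
    rw [abs_le]; constructor <;> linarith
  have hC₁0 : 0 ≤ C₁ := by
    have := hC₁ 0 ∅ (by simp)
    simp at this
    nlinarith [Real.log_pos (by norm_num : (1 : ℝ) < 2)]
  have hC₂0 : 0 ≤ C₂ := by
    have := hC₂ 0 25 le_rfl ∅ (by simp)
    simp at this
    by_contra h
    push Not at h
    have : C₂ * 25 ^ 2 * Real.exp (-(4 / 5 * √25)) * Real.log 2 < 0 := by
      have h1 : 0 < (25 : ℝ) ^ 2 * Real.exp (-(4 / 5 * √25)) * Real.log 2 := by
        have := Real.log_pos (by norm_num : (1 : ℝ) < 2); positivity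
      nlinarith
    linarith
  have hlog2L : Real.log (|ρ.im| + 2) ≤ 2 * L := log_abs_im_add_two_le hT4 hγ1 hγ2
  rw [← Finset.sum_filter_add_sum_filter_not F (fun ρ' ↦ L ^ 2 < ‖ρ' - ρ‖)]
  refine add_le_add ?_ ?_
  · -- the far zeros
    set Ff := F.filter (fun ρ' ↦ L ^ 2 < ‖ρ' - ρ‖) with hFf_def
    have hFf : ∀ ρ' ∈ Ff, ρ' ∈ RHWave0.riemannZetaNontrivialZeros ∧ L ^ 2 - 1 ≤ |ρ'.im - ρ.im| := by
      intro ρ' h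
      rw [hFf_def, Finset.mem_filter] at h
      refine ⟨(hF ρ' h.1).1, ?_⟩
      have h3 := Complex.norm_le_abs_re_add_abs_im (ρ' - ρ)
      rw [sub_re, sub_im] at h3
      linarith [hre1 ρ' h.1, h.2]
    have hterm : ∀ ρ' ∈ Ff, ‖(riemannZetaZeroOrder ρ' : ℂ) *
        (((Real.exp u : ℝ) : ℂ) ^ (ρ' - ρ) * mellin (fun x : ℝ ↦ ((w0 x : ℝ) : ℂ)) (ρ' - ρ))‖ ≤
        (riemannZetaZeroOrder ρ' : ℝ) *
          (Real.exp (L / 2) * (2 * Cc * Real.exp (-(4 / 5 * √|ρ'.im - ρ.im|)))) := by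
      intro ρ' h
      have hF1 := (Finset.mem_filter.1 h).1
      rw [norm_zeroTerm_eq (hm ρ' hF1)]
      refine mul_le_mul_of_nonneg_left ?_ (hm' ρ' hF1)
      have hre' : (ρ' - ρ).re ≤ 1 / 2 := by
        rw [sub_re]; linarith [re_lt_one (hF ρ' hF1).1]
      have hW := hCc (ρ' - ρ)
      rw [sub_im] at hW
      have h22 : (2 : ℝ) ^ |(ρ' - ρ).re| ≤ 2 := by
        calc (2 : ℝ) ^ |(ρ' - ρ).re| ≤ 2 ^ (1 : ℝ) :=
              Real.rpow_le_rpow_of_exponent_le one_le_two (by rw [sub_re]; exact hre1 ρ' hF1)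
          _ = 2 := Real.rpow_one 2
      have hW' : ‖mellin (fun x : ℝ ↦ ((w0 x : ℝ) : ℂ)) (ρ' - ρ)‖ ≤
          2 * Cc * Real.exp (-(4 / 5 * √|ρ'.im - ρ.im|)) := by
        calc ‖mellin (fun x : ℝ ↦ ((w0 x : ℝ) : ℂ)) (ρ' - ρ)‖
            ≤ Cc * 2 ^ |(ρ' - ρ).re| * Real.exp (-(4 / 5 * √|ρ'.im - ρ.im|)) := hW
          _ ≤ Cc * 2 * Real.exp (-(4 / 5 * √|ρ'.im - ρ.im|)) :=
              mul_le_mul_of_nonneg_right (mul_le_mul_of_nonneg_left h22 hCc0) (Real.exp_pos _).le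
          _ = _ := by ring
      have hE : Real.exp (u * (ρ' - ρ).re) ≤ Real.exp (L / 2) := by
        rw [Real.exp_le_exp]
        have := mul_le_mul_of_nonneg_left hre' hu0
        linarith
      exact mul_le_mul hE hW' (norm_nonneg _) (Real.exp_pos _).le
    have hsqrt : L - 1 ≤ √(L ^ 2 - 1) := by
      rw [Real.le_sqrt (by linarith) (by nlinarith)]; nlinarith
    calc ∑ ρ' ∈ Ff, ‖(riemannZetaZeroOrder ρ' : ℂ) *
          (((Real.exp u : ℝ) : ℂ) ^ (ρ' - ρ) * mellin (fun x : ℝ ↦ ((w0 x : ℝ) : ℂ)) (ρ' - ρ))‖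
        ≤ ∑ ρ' ∈ Ff, (riemannZetaZeroOrder ρ' : ℝ) *
          (Real.exp (L / 2) * (2 * Cc * Real.exp (-(4 / 5 * √|ρ'.im - ρ.im|)))) :=
          Finset.sum_le_sum hterm
      _ = 2 * Cc * Real.exp (L / 2) *
          ∑ ρ' ∈ Ff, (riemannZetaZeroOrder ρ' : ℝ) * Real.exp (-(4 / 5 * √|ρ'.im - ρ.im|)) := by
          rw [Finset.mul_sum]; refine Finset.sum_congr rfl fun ρ' _ ↦ by ring
      _ ≤ 2 * Cc * Real.exp (L / 2) * (C₂ * (L ^ 2 - 1) ^ 2 * Real.exp (-(4 / 5 * √(L ^ 2 - 1))) *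
          Real.log (|ρ.im| + 2)) := by
          gcongr
          exact hC₂ ρ.im (L ^ 2 - 1) (by nlinarith) Ff hFf
      _ ≤ 2 * Cc * Real.exp (L / 2) * (C₂ * L ^ 4 * (Real.exp (4 / 5) * Real.exp (-(4 / 5 * L))) *
          (2 * L)) := by
          have ha : (L ^ 2 - 1) ^ 2 ≤ L ^ 4 := by nlinarith
          have hb : Real.exp (-(4 / 5 * √(L ^ 2 - 1))) ≤ Real.exp (4 / 5) * Real.exp (-(4 / 5 * L)) := by
            rw [← Real.exp_add, Real.exp_le_exp]; nlinarith
          have h1 : C₂ * (L ^ 2 - 1) ^ 2 * Real.exp (-(4 / 5 * √(L ^ 2 - 1))) ≤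
              C₂ * L ^ 4 * (Real.exp (4 / 5) * Real.exp (-(4 / 5 * L))) :=
            mul_le_mul (mul_le_mul_of_nonneg_left ha hC₂0) hb (Real.exp_pos _).le
              (mul_nonneg hC₂0 (by positivity))
          have h2 := mul_le_mul h1 hlog2L (Real.log_nonneg (by linarith [abs_nonneg ρ.im]))
            (mul_nonneg (mul_nonneg hC₂0 (by positivity)) (by positivity))
          exact mul_le_mul_of_nonneg_left h2 (by positivity)
      _ = _ := by ring
  · -- the near zeros, to the left by half-isolation
    set Fn := F.filter (fun ρ' ↦ ¬ L ^ 2 < ‖ρ' - ρ‖) with hFn_def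
    have hleft : ∀ ρ' ∈ Fn, ρ'.re ≤ ρ.re - Real.log L ^ 2 / A := by
      intro ρ' h
      obtain ⟨h1, h2⟩ := Finset.mem_filter.1 h
      push Not at h2
      obtain ⟨hZ', hnot⟩ := hF ρ' h1
      rcases hiso.near_of_le_im hTe hγ1 (zeta_eq_zero hZ') h2 with hc | hc
      · exact absurd ⟨h2, hc.1, hc.2⟩ hnot
      · exact hc
    have hlogL2 : 0 ≤ Real.log L ^ 2 := sq_nonneg _
    have hterm : ∀ ρ' ∈ Fn, ‖(riemannZetaZeroOrder ρ' : ℂ) *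
        (((Real.exp u : ℝ) : ℂ) ^ (ρ' - ρ) * mellin (fun x : ℝ ↦ ((w0 x : ℝ) : ℂ)) (ρ' - ρ))‖ ≤
        (riemannZetaZeroOrder ρ' : ℝ) *
          (Real.exp (-(Real.log L ^ 2)) * (2 * Cb / (1 + (ρ'.im - ρ.im) ^ 2))) := by
      intro ρ' h
      have hF1 := (Finset.mem_filter.1 h).1
      rw [norm_zeroTerm_eq (hm ρ' hF1)]
      refine mul_le_mul_of_nonneg_left ?_ (hm' ρ' hF1)
      have hre' : (ρ' - ρ).re ≤ -(Real.log L ^ 2 / A) := by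
        rw [sub_re]; linarith [hleft ρ' h]
      have hE : Real.exp (u * (ρ' - ρ).re) ≤ Real.exp (-(Real.log L ^ 2)) := by
        rw [Real.exp_le_exp]
        have huA : 1 ≤ u / A := by rw [le_div_iff₀ hA0]; linarith
        calc u * (ρ' - ρ).re ≤ u * (-(Real.log L ^ 2 / A)) := mul_le_mul_of_nonneg_left hre' hu0
          _ = -(Real.log L ^ 2) * (u / A) := by ring
          _ ≤ -(Real.log L ^ 2) * 1 := mul_le_mul_of_nonpos_left huA (by linarith)
          _ = _ := mul_one _
      exact mul_le_mul hE (norm_W0_sub_le_of_re hCb (hre1 ρ' hF1)) (norm_nonneg _) (Real.exp_pos _).le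
    calc ∑ ρ' ∈ Fn, ‖(riemannZetaZeroOrder ρ' : ℂ) *
          (((Real.exp u : ℝ) : ℂ) ^ (ρ' - ρ) * mellin (fun x : ℝ ↦ ((w0 x : ℝ) : ℂ)) (ρ' - ρ))‖
        ≤ ∑ ρ' ∈ Fn, (riemannZetaZeroOrder ρ' : ℝ) *
          (Real.exp (-(Real.log L ^ 2)) * (2 * Cb / (1 + (ρ'.im - ρ.im) ^ 2))) :=
          Finset.sum_le_sum hterm
      _ = 2 * Cb * Real.exp (-(Real.log L ^ 2)) *
          ∑ ρ' ∈ Fn, (riemannZetaZeroOrder ρ' : ℝ) / (1 + (ρ'.im - ρ.im) ^ 2) := by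
          rw [Finset.mul_sum]; refine Finset.sum_congr rfl fun ρ' _ ↦ by ring
      _ ≤ 2 * Cb * Real.exp (-(Real.log L ^ 2)) * (C₁ * Real.log (|ρ.im| + 2)) := by
          gcongr
          exact hC₁ ρ.im Fn fun ρ' h ↦ (hF ρ' (Finset.mem_filter.1 h).1).1
      _ ≤ 2 * Cb * Real.exp (-(Real.log L ^ 2)) * (C₁ * (2 * L)) := by gcongr
      _ = _ := by ring

/-! ## Proposition 16: thresholds -/

/-- Far zeros are negligible: `K L⁵ e^{L/2} e^{−(4/5)L} ≤ 1/(8L^{100})` for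
`L ≥ (8K+1)·106!/(3/10)^{106}`. [folklore] -/
theorem far_small {K L : ℝ} (hK : 0 ≤ K) (hL1 : 1 ≤ L)
    (hL : (8 * K + 1) * (106).factorial / (3 / 10) ^ 106 ≤ L) :
    K * L ^ 5 * Real.exp (L / 2) * Real.exp (-(4 / 5 * L)) ≤ 1 / (8 * L ^ 100) := by
  have hL0 : 0 < L := by linarith
  have hexp : Real.exp (L / 2) * Real.exp (-(4 / 5 * L)) = (Real.exp (3 / 10 * L))⁻¹ := by
    rw [← Real.exp_add, ← Real.exp_neg]; congr 1; ring
  have hfac := Real.pow_div_factorial_le_exp (3 / 10 * L) (by positivity) 106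
  have hfpos : (0 : ℝ) < (106).factorial := by positivity
  have hkey : 8 * K * L ^ 105 ≤ (3 / 10 * L) ^ 106 / (106).factorial := by
    rw [le_div_iff₀ hfpos, mul_pow]
    have h1 : (8 * K) * (106).factorial / (3 / 10) ^ 106 ≤ L := by
      refine le_trans ?_ hL
      gcongr
      linarith
    rw [div_le_iff₀ (by positivity)] at h1
    calc 8 * K * L ^ 105 * (106).factorial = ((8 * K) * (106).factorial) * L ^ 105 := by ring
      _ ≤ (L * (3 / 10) ^ 106) * L ^ 105 := by gcongr
      _ = (3 / 10) ^ 106 * L ^ 106 := by ring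
  have hXpos : (0 : ℝ) < (3 / 10 * L) ^ 106 / (106).factorial := by positivity
  calc K * L ^ 5 * Real.exp (L / 2) * Real.exp (-(4 / 5 * L))
      = K * L ^ 5 * (Real.exp (3 / 10 * L))⁻¹ := by rw [mul_assoc (K * L ^ 5), hexp]
    _ ≤ K * L ^ 5 * ((3 / 10 * L) ^ 106 / (106).factorial)⁻¹ := by gcongr
    _ = K * L ^ 5 / ((3 / 10 * L) ^ 106 / (106).factorial) := by ring
    _ ≤ 1 / (8 * L ^ 100) := by
        rw [div_le_div_iff₀ hXpos (by positivity), one_mul,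
          show K * L ^ 5 * (8 * L ^ 100) = 8 * K * L ^ 105 by ring]
        exact hkey

/-- The pole term is negligible: `2C_b e^{L/2} e^{−2L} ≤ 1/(4L^{100})` for
`L ≥ (8C_b+1)·101!/(3/2)^{101}`. [folklore] -/
theorem pole_small {K L : ℝ} (hK : 0 ≤ K) (hL1 : 1 ≤ L)
    (hL : (8 * K + 1) * (101).factorial / (3 / 2) ^ 101 ≤ L) :
    2 * K * Real.exp (L / 2) * Real.exp (-(2 * L)) ≤ 1 / (4 * L ^ 100) := by
  have hL0 : 0 < L := by linarith
  have hexp : Real.exp (L / 2) * Real.exp (-(2 * L)) = (Real.exp (3 / 2 * L))⁻¹ := by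
    rw [← Real.exp_add, ← Real.exp_neg]; congr 1; ring
  have hfac := Real.pow_div_factorial_le_exp (3 / 2 * L) (by positivity) 101
  have hfpos : (0 : ℝ) < (101).factorial := by positivity
  have hkey : 8 * K * L ^ 100 ≤ (3 / 2 * L) ^ 101 / (101).factorial := by
    rw [le_div_iff₀ hfpos, mul_pow]
    have h1 : (8 * K) * (101).factorial / (3 / 2) ^ 101 ≤ L := by
      refine le_trans ?_ hL
      gcongr
      linarith
    rw [div_le_iff₀ (by positivity)] at h1
    calc 8 * K * L ^ 100 * (101).factorial = ((8 * K) * (101).factorial) * L ^ 100 := by ring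
      _ ≤ (L * (3 / 2) ^ 101) * L ^ 100 := by gcongr
      _ = (3 / 2) ^ 101 * L ^ 101 := by ring
  have hXpos : (0 : ℝ) < (3 / 2 * L) ^ 101 / (101).factorial := by positivity
  calc 2 * K * Real.exp (L / 2) * Real.exp (-(2 * L))
      = 2 * K * (Real.exp (3 / 2 * L))⁻¹ := by rw [mul_assoc (2 * K), hexp]
    _ ≤ 2 * K * ((3 / 2 * L) ^ 101 / (101).factorial)⁻¹ := by gcongr
    _ = 2 * K / ((3 / 2 * L) ^ 101 / (101).factorial) := by ring
    _ ≤ 1 / (4 * L ^ 100) := by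
        rw [div_le_div_iff₀ hXpos (by positivity), one_mul,
          show 2 * K * (4 * L ^ 100) = 8 * K * L ^ 100 by ring]
        exact hkey

/-- The near (left) zeros are negligible: `4K L e^{−(log L)²} ≤ 1/(8L^{100})` once
`log L ≥ 102 + log(32K + 1)`. [folklore] -/
theorem near_small {K L : ℝ} (hK : 0 ≤ K) (hL1 : 1 ≤ L)
    (hL : 102 + Real.log (32 * K + 1) ≤ Real.log L) :
    4 * K * L * Real.exp (-(Real.log L ^ 2)) ≤ 1 / (8 * L ^ 100) := by
  have hL0 : 0 < L := by linarith
  have hlogK : 0 ≤ Real.log (32 * K + 1) := Real.log_nonneg (by linarith)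
  have hM1 : 1 ≤ Real.log L := by linarith
  -- `32 K L^{101} ≤ exp((log L)²)`
  have hpow : L ^ 101 = Real.exp (101 * Real.log L) := by
    rw [show (101 : ℝ) * Real.log L = ((101 : ℕ) : ℝ) * Real.log L by norm_num, Real.exp_nat_mul,
      Real.exp_log hL0]
  have hK32 : 32 * K ≤ Real.exp (Real.log (32 * K + 1)) := by
    rw [Real.exp_log (by linarith)]; linarith
  have hmain : 32 * K * L ^ 101 ≤ Real.exp (Real.log L ^ 2) := by
    calc 32 * K * L ^ 101 ≤ Real.exp (Real.log (32 * K + 1)) * Real.exp (101 * Real.log L) := by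
          rw [hpow]; gcongr
      _ = Real.exp (Real.log (32 * K + 1) + 101 * Real.log L) := (Real.exp_add _ _).symm
      _ ≤ Real.exp (Real.log L ^ 2) := by
          rw [Real.exp_le_exp]
          nlinarith [mul_nonneg hlogK (by linarith : 0 ≤ Real.log L - 1)]
  rw [le_div_iff₀ (by positivity),
    show 4 * K * L * Real.exp (-(Real.log L ^ 2)) * (8 * L ^ 100) =
      (32 * K * L ^ 101) * Real.exp (-(Real.log L ^ 2)) by ring]
  calc (32 * K * L ^ 101) * Real.exp (-(Real.log L ^ 2))
      ≤ Real.exp (Real.log L ^ 2) * Real.exp (-(Real.log L ^ 2)) :=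
        mul_le_mul_of_nonneg_right hmain (Real.exp_pos _).le
    _ = 1 := by rw [← Real.exp_add]; simp

/-- The trivial-zero terms are negligible: `24 e^{−2(log L)³} ≤ 1/(4L^{100})` once `log L ≥ 8`.
[folklore] -/
theorem triv_small {L : ℝ} (hL1 : 1 ≤ L) (hL : 8 ≤ Real.log L) :
    24 * Real.exp (-(2 * Real.log L ^ 3)) ≤ 1 / (4 * L ^ 100) := by
  have hL0 : 0 < L := by linarith
  have hpow : L ^ 100 = Real.exp (100 * Real.log L) := by
    rw [show (100 : ℝ) * Real.log L = ((100 : ℕ) : ℝ) * Real.log L by norm_num, Real.exp_nat_mul,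
      Real.exp_log hL0]
  have h96 : (96 : ℝ) ≤ Real.exp 5 := by
    have h1 : Real.exp 5 = Real.exp 1 ^ 5 := by rw [← Real.exp_nat_mul]; norm_num
    rw [h1]
    have he := Real.exp_one_gt_d9
    nlinarith [pow_le_pow_left₀ (by norm_num : (0 : ℝ) ≤ 2.7182818283) he.le 5]
  have hmain : 96 * L ^ 100 ≤ Real.exp (2 * Real.log L ^ 3) := by
    calc 96 * L ^ 100 ≤ Real.exp 5 * Real.exp (100 * Real.log L) := by rw [hpow]; gcongr
      _ = Real.exp (5 + 100 * Real.log L) := (Real.exp_add _ _).symm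
      _ ≤ Real.exp (2 * Real.log L ^ 3) := by
          rw [Real.exp_le_exp]
          have h64 : 64 ≤ Real.log L ^ 2 := by nlinarith
          nlinarith
  rw [le_div_iff₀ (by positivity),
    show 24 * Real.exp (-(2 * Real.log L ^ 3)) * (4 * L ^ 100) =
      (96 * L ^ 100) * Real.exp (-(2 * Real.log L ^ 3)) by ring]
  calc (96 * L ^ 100) * Real.exp (-(2 * Real.log L ^ 3))
      ≤ Real.exp (2 * Real.log L ^ 3) * Real.exp (-(2 * Real.log L ^ 3)) :=
        mul_le_mul_of_nonneg_right hmain (Real.exp_pos _).le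
    _ = 1 := by rw [← Real.exp_add]; simp


/-! ## Proposition 16: the grid and the assembly -/

/-- `log(1 + x) ≥ x/2` for `0 ≤ x ≤ 1`. [folklore] -/
theorem half_le_log_one_add {x : ℝ} (h0 : 0 ≤ x) (h1 : x ≤ 1) : x / 2 ≤ Real.log (1 + x) := by
  rw [Real.le_log_iff_exp_le (by linarith)]
  have h2 : Real.exp (x / 2) ≤ 1 / (1 - x / 2) := by
    rw [le_div_iff₀ (by linarith)]
    have := Real.add_one_le_exp (-(x / 2))
    have h3 : Real.exp (x / 2) * Real.exp (-(x / 2)) = 1 := by rw [← Real.exp_add]; simp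
    nlinarith [Real.exp_pos (x / 2)]
  have h4 : 1 / (1 - x / 2) ≤ 1 + x := by
    rw [div_le_iff₀ (by linarith)]; nlinarith
  linarith

/-- **`#𝒰 ≤ (log T)^{152}`**: with `ℓ = log(1 + L^{−150}) ≥ L^{−150}/2`, the grid
`{e^{jℓ} : j ≤ ⌈2L/ℓ⌉ + 1}` has at most `4L^{151} + 3 ≤ L^{152}` points (`L ≥ 5`).
[cite: MaynardPratt2024, Proposition 16 (proof)] -/
theorem grid_card_le {L : ℝ} (hL : 5 ≤ L) :
    ((⌈2 * L / Real.log (1 + (L ^ 150)⁻¹)⌉₊ + 1 + 1 : ℕ) : ℝ) ≤ L ^ 152 := by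
  set ℓ := Real.log (1 + (L ^ 150)⁻¹) with hℓ_def
  have hL1 : 1 ≤ L := by linarith
  have hL150 : (1 : ℝ) ≤ L ^ 150 := one_le_pow₀ hL1
  have hinv0 : (0 : ℝ) < (L ^ 150)⁻¹ := by positivity
  have hinv1 : (L ^ 150)⁻¹ ≤ (1 : ℝ) := inv_le_one_of_one_le₀ hL150
  have hℓ : (L ^ 150)⁻¹ / 2 ≤ ℓ := half_le_log_one_add hinv0.le hinv1
  have hℓ0 : 0 < ℓ := lt_of_lt_of_le (by positivity) hℓ
  have h1 : 2 * L / ℓ ≤ 4 * L ^ 151 := by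
    rw [div_le_iff₀ hℓ0]
    calc 2 * L = 4 * L ^ 151 * ((L ^ 150)⁻¹ / 2) := by field_simp; norm_num
      _ ≤ 4 * L ^ 151 * ℓ := by gcongr
  have h2 : ((⌈2 * L / ℓ⌉₊ : ℕ) : ℝ) < 2 * L / ℓ + 1 := Nat.ceil_lt_add_one (by positivity)
  have h151 : L ≤ L ^ 151 := by
    calc L = L ^ 1 := (pow_one L).symm
      _ ≤ L ^ 151 := pow_le_pow_right₀ hL1 (by norm_num)
  push_cast
  nlinarith

/-- `‖M‖ ≤ ‖P − (M + R) − E‖ + ‖P‖ + ‖R‖ + ‖E‖`. [folklore] -/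
theorem norm_main_le (P M R E : ℂ) : ‖M‖ ≤ ‖P - (M + R) - E‖ + ‖P‖ + ‖R‖ + ‖E‖ := by
  have h : M = P - (P - (M + R) - E) - R - E := by ring
  calc ‖M‖ = ‖P - (P - (M + R) - E) - R - E‖ := by rw [← h]
    _ ≤ ‖P - (P - (M + R) - E) - R‖ + ‖E‖ := norm_sub_le _ _
    _ ≤ ‖P - (P - (M + R) - E)‖ + ‖R‖ + ‖E‖ := by gcongr; exact norm_sub_le _ _
    _ ≤ ‖P‖ + ‖P - (M + R) - E‖ + ‖R‖ + ‖E‖ := by gcongr; exact norm_sub_le _ _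
    _ = _ := by ring

set_option maxHeartbeats 1000000 in
open ZetaZeros.riemannZetaNontrivialZeros in
/-- **Maynard–Pratt 2024, Proposition 16, from Lemma 11.** The named fact
`MaynardPratt2024_prop16` (short zero-detecting polynomial for `Y`-half-isolated zeros) follows
from the named fact `MaynardPratt2024_lemma11` (the refined power-sum estimate). The proof is the
printed one (p. 10–11): the grid `𝒰 = {(1 + (log T)^{−150})^j}`, the explicit formula for
`S(U) = Σ Λ(n) n^{−ρ₀} w₀(n/U)` at the zero `ρ₀` (`HalfIsolatedZeroExplicit.lean`), the pole term
and the trivial zeros being negligible, the far zeros by the sub-exponential Mellin decay of `w₀`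
(`HalfIsolatedZeroMellin.lean`; this is where `log Y ≤ (log T)/2` is used: `|U^{ρ−ρ₀}| ≤ T^{1/2}`),
the near zeros outside `𝒮_≈` by half-isolation, and the main sum over `𝒮_≈` by Lemma 15
(`lemma15`), with the absolute constant `c = 1`. [cite: MaynardPratt2024, Proposition 16] -/
theorem _root_.Literature.NumberTheory.LFunctions.MaynardPratt2024_prop16_of_lemma11
    (h11 : Literature.Analysis.Complex.MaynardPratt2024_lemma11) : MaynardPratt2024_prop16 := by
  classical
  obtain ⟨L₁, hL₁0, h15⟩ := lemma15 h11
  obtain ⟨Cb, hCb0, hCb⟩ := exists_norm_W0_le_div_one_add_sq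
  obtain ⟨Cc, hCc0, hCc⟩ := exists_norm_W0_le_exp_neg_sqrt
  obtain ⟨C₁, hC₁0, hC₁⟩ := exists_sum_order_div_one_add_sq_le
  obtain ⟨C₂, hC₂0, hC₂⟩ := exists_sum_order_mul_exp_neg_sqrt_le
  -- thresholds
  set Kf : ℝ := 4 * Cc * C₂ * Real.exp (4 / 5) with hKf
  have hKf0 : 0 ≤ Kf := by positivity
  set Lfar : ℝ := (8 * Kf + 1) * (106).factorial / (3 / 10) ^ 106 with hLfar
  set Lpole : ℝ := (8 * Cb + 1) * (101).factorial / (3 / 2) ^ 101 with hLpole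
  set Lnear : ℝ := Real.exp (102 + Real.log (32 * (Cb * C₁) + 1)) with hLnear
  have hLfar0 : 0 ≤ Lfar := by positivity
  have hLpole0 : 0 ≤ Lpole := by positivity
  have hLnear0 : 0 ≤ Lnear := (Real.exp_pos _).le
  have he8 : 0 ≤ Real.exp 8 := (Real.exp_pos _).le
  set L₂ : ℝ := L₁ + Lfar + Lpole + Lnear + Real.exp 8 + 6 with hL₂
  refine ⟨1, one_pos, Real.exp L₂, fun T hT ↦ ?_⟩
  set L := Real.log T with hL_def
  have hTpos : 0 < T := lt_of_lt_of_le (Real.exp_pos _) hT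
  have hL : L₂ ≤ L := by
    rw [hL_def, ← Real.log_exp L₂]; exact Real.log_le_log (Real.exp_pos _) hT
  have hLL₁ : L₁ ≤ L := by linarith
  have hLLfar : Lfar ≤ L := by linarith
  have hLLpole : Lpole ≤ L := by linarith
  have hL6 : 6 ≤ L := by linarith
  have hL1 : 1 ≤ L := by linarith
  have hL0 : 0 < L := by linarith
  have hlogL8 : 8 ≤ Real.log L := by
    rw [Real.le_log_iff_exp_le hL0]; linarith
  have hlogLnear : 102 + Real.log (32 * (Cb * C₁) + 1) ≤ Real.log L := by
    rw [Real.le_log_iff_exp_le hL0]; linarith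
  have hT_exp : T = Real.exp L := by rw [hL_def, Real.exp_log hTpos]
  -- the grid
  set ℓ := Real.log (1 + (L ^ 150)⁻¹) with hℓ_def
  have hL150 : (1 : ℝ) ≤ L ^ 150 := one_le_pow₀ hL1
  have hinv0 : (0 : ℝ) < (L ^ 150)⁻¹ := by positivity
  have hℓ0 : 0 < ℓ := Real.log_pos (by linarith)
  set J : ℕ := ⌈2 * L / ℓ⌉₊ + 1 with hJ
  set 𝒰 : Finset ℝ := ((Finset.range (J + 1)).image (fun j : ℕ ↦ Real.exp (j * ℓ))).filter
      (fun U ↦ Real.exp (Real.log L ^ 3) ≤ U ∧ U ≤ T ^ 2) with h𝒰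
  refine ⟨𝒰, ?_, ?_, ?_⟩
  · -- cardinality
    have hcard := grid_card_le (by linarith : 5 ≤ L)
    rw [← hℓ_def, ← hJ] at hcard
    calc (𝒰.card : ℝ) ≤ (((Finset.range (J + 1)).image (fun j : ℕ ↦ Real.exp (j * ℓ))).card : ℝ) := by
          rw [h𝒰]; exact_mod_cast Finset.card_filter_le _ _
      _ ≤ ((Finset.range (J + 1)).card : ℝ) := by exact_mod_cast Finset.card_image_le
      _ = (J + 1 : ℕ) := by rw [Finset.card_range]
      _ ≤ L ^ 152 := hcard
  · intro U hU
    rw [h𝒰, Finset.mem_filter] at hU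
    exact hU.2
  · intro Y hA1 hA2 ρ hiso hβ hγ1 hγ2
    set A := Real.log Y with hA_def
    have hA512 : (512 : ℝ) ≤ A := by
      have : (8 : ℝ) ^ 3 ≤ Real.log L ^ 3 := pow_le_pow_left₀ (by norm_num) hlogL8 3
      norm_num at this; linarith
    have hA0 : 0 < A := by linarith
    have hρZ : ρ ∈ RHWave0.riemannZetaNontrivialZeros := mem_of_re_pos hiso.zero (by linarith)
    have hβ1 : ρ.re < 1 := re_lt_one hρZ
    -- the set `𝒮_≈`
    set S : Finset ℂ := (riemannZetaNontrivialZeros_finite_inter_ball ρ (L ^ 2 + 1)).toFinset.filter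
      (fun ρ' ↦ ‖ρ' - ρ‖ ≤ L ^ 2 ∧ |ρ'.re - ρ.re| ≤ 1 / (10 * A) ∧ ρ.im ≤ ρ'.im) with hS_def
    have hSmem : ∀ ρ' : ℂ, ρ' ∈ S ↔ ρ' ∈ RHWave0.riemannZetaNontrivialZeros ∧ ‖ρ' - ρ‖ ≤ L ^ 2 ∧
        |ρ'.re - ρ.re| ≤ 1 / (10 * A) ∧ ρ.im ≤ ρ'.im := by
      intro ρ'
      rw [hS_def, Finset.mem_filter, Set.Finite.mem_toFinset, Set.mem_inter_iff, Metric.mem_ball,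
        dist_eq_norm]
      constructor
      · rintro ⟨⟨hZ, -⟩, h⟩; exact ⟨hZ, h⟩
      · rintro ⟨hZ, h⟩; exact ⟨⟨hZ, by linarith [h.1]⟩, h⟩
    have hρS : ρ ∈ S := (hSmem ρ).2 ⟨hρZ, by simp; positivity, by simp; positivity, le_rfl⟩
    have hS : ∀ ρ' ∈ S, ρ' ∈ RHWave0.riemannZetaNontrivialZeros ∧ ρ.im ≤ ρ'.im ∧
        |ρ'.re - ρ.re| ≤ 1 / (10 * A) ∧ ‖ρ' - ρ‖ ≤ L ^ 2 := fun ρ' h ↦ by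
      obtain ⟨a, b, c, d⟩ := (hSmem ρ').1 h; exact ⟨a, d, c, b⟩
    -- Lemma 15
    obtain ⟨j, hj1, hj2, hmain⟩ := h15 T Y ρ S hLL₁ hA1 (by linarith) hρZ hγ1 hγ2 hρS hS
    set u : ℝ := j * ℓ with hu_def
    set U : ℝ := Real.exp u with hU_def
    have hY0 : 0 < Y := lt_trans zero_lt_one hiso.one_lt
    have hYexp : Y = Real.exp A := by rw [hA_def, Real.exp_log hY0]
    have hu1 : A ≤ u := hj1
    have hu2 : u ≤ 2 * A := hj2
    have huL : u ≤ L := by linarith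
    have hYU : Y ≤ U := by rw [hYexp, hU_def]; exact Real.exp_le_exp.2 hu1
    have hY2 : Y ^ 2 = Real.exp (2 * A) := by
      rw [hYexp, ← Real.exp_nat_mul]; norm_num
    have hUY : U ≤ Y ^ 2 := by rw [hY2, hU_def]; exact Real.exp_le_exp.2 hu2
    have hU3 : 3 ≤ U := by
      rw [hU_def]
      have : (512 : ℝ) + 1 ≤ Real.exp 512 := Real.add_one_le_exp 512
      have h2 : Real.exp 512 ≤ Real.exp u := Real.exp_le_exp.2 (by linarith)
      linarith
    have hU1 : 1 ≤ U := by linarith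
    have hT2 : T ^ 2 = Real.exp (2 * L) := by rw [hT_exp, ← Real.exp_nat_mul]; norm_num
    refine ⟨U, ?_, hYU, hUY, ?_⟩
    · -- `U ∈ 𝒰`
      rw [h𝒰, Finset.mem_filter, Finset.mem_image]
      refine ⟨⟨j, ?_, rfl⟩, ?_, ?_⟩
      · rw [Finset.mem_range]
        have h1 : (j : ℝ) * ℓ ≤ L := huL
        have h2 : (2 * L / ℓ : ℝ) ≤ ⌈2 * L / ℓ⌉₊ := Nat.le_ceil _
        have h3 : (j : ℝ) < J := by
          rw [hJ]; push_cast
          have : (j : ℝ) ≤ L / ℓ := by rw [le_div_iff₀ hℓ0]; exact h1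
          have h4 : L / ℓ < 2 * L / ℓ := by
            rw [div_lt_div_iff_of_pos_right hℓ0]; linarith
          linarith
        have : j < J := by exact_mod_cast h3
        omega
      · rw [hU_def]; exact Real.exp_le_exp.2 (le_trans hA1 hu1)
      · rw [hT2, hU_def]; exact Real.exp_le_exp.2 (by linarith)
    · -- the lower bound `1/(log T)^100 ≤ |S_U(ρ)|`
      obtain ⟨hsZ, hsT, hformula⟩ := smoothedVonMangoldt_w0_eq_explicit (by linarith : 2 ≤ U) hρZ
      rw [hformula]
      set P : ℂ := (U : ℂ) ^ (1 - ρ) * mellin (fun x : ℝ ↦ ((w0 x : ℝ) : ℂ)) (1 - ρ) with hP_def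
      set g : ℂ → ℂ := fun ρ' ↦ (riemannZetaZeroOrder ρ' : ℂ) *
        ((U : ℂ) ^ (ρ' - ρ) * mellin (fun x : ℝ ↦ ((w0 x : ℝ) : ℂ)) (ρ' - ρ)) with hg_def
      set TS : ℂ := ∑' k : ℕ, (U : ℂ) ^ (-(ρ + 2 * ((k : ℂ) + 1))) *
          mellin (fun x : ℝ ↦ ((w0 x : ℝ) : ℂ)) (-(ρ + 2 * ((k : ℂ) + 1))) with hTS_def
      -- the pole term
      have hP : ‖P‖ ≤ 1 / (4 * L ^ 100) := by
        have h1 := norm_pole_term_le hCb hU1 hβ hβ1.le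
        have hU12 : U ^ (1 / 2 : ℝ) ≤ Real.exp (L / 2) := by
          rw [hU_def, ← Real.exp_mul, Real.exp_le_exp]; linarith
        have hγT : T ^ 2 ≤ 1 + ρ.im ^ 2 := by nlinarith
        calc ‖P‖ ≤ 2 * Cb * U ^ (1 / 2 : ℝ) / (1 + ρ.im ^ 2) := h1
          _ ≤ 2 * Cb * Real.exp (L / 2) / T ^ 2 := by
              gcongr
          _ = 2 * Cb * Real.exp (L / 2) * Real.exp (-(2 * L)) := by
              rw [hT2, Real.exp_neg, div_eq_mul_inv]
          _ ≤ 1 / (4 * L ^ 100) := pole_small hCb0.le hL1 hLLpole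
      -- the trivial zeros
      have hTS : ‖TS‖ ≤ 1 / (4 * L ^ 100) := by
        refine (norm_tsum_trivial_le hU3 (by linarith : 0 ≤ ρ.re)).trans ?_
        have hU2 : U ^ 2 = Real.exp (2 * u) := by rw [hU_def, ← Real.exp_nat_mul]; norm_num
        calc 24 / U ^ 2 = 24 * Real.exp (-(2 * u)) := by rw [hU2, Real.exp_neg, div_eq_mul_inv]
          _ ≤ 24 * Real.exp (-(2 * Real.log L ^ 3)) := by gcongr; linarith
          _ ≤ 1 / (4 * L ^ 100) := triv_small hL1 hlogL8
      -- the zero sum: split off `𝒮_≈`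
      set SZ : Finset RHWave0.riemannZetaNontrivialZeros :=
        S.subtype (· ∈ RHWave0.riemannZetaNontrivialZeros) with hSZ
      have hsplit := hsZ.of_norm.sum_add_tsum_subtype_compl SZ
      have hfin : ∑ x ∈ SZ, g (x : ℂ) = ∑ ρ' ∈ S, (riemannZetaZeroOrder ρ' : ℂ) *
          (cexp ((u : ℂ) * (ρ' - ρ)) * mellin (fun x : ℝ ↦ ((w0 x : ℝ) : ℂ)) (ρ' - ρ)) := by
        rw [hSZ, Finset.sum_subtype_eq_sum_filter, Finset.filter_true_of_mem fun ρ' h ↦ (hS ρ' h).1]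
        refine Finset.sum_congr rfl fun ρ' _ ↦ ?_
        rw [hg_def]
        simp only [hU_def]
        rw [show ((Real.exp u : ℝ) : ℂ) ^ (ρ' - ρ) = cexp ((u : ℂ) * (ρ' - ρ)) by
          rw [Complex.ofReal_exp, Complex.cpow_def_of_ne_zero (Complex.exp_ne_zero _),
            Complex.log_exp (by simp [Real.pi_pos]) (by simpa using Real.pi_pos.le)]]
      have hR : ‖∑' x : {x // x ∉ SZ}, g (x : ℂ)‖ ≤ 1 / (4 * L ^ 100) := by
        refine (norm_tsum_le_tsum_norm (hsZ.subtype _)).trans ?_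
        refine Real.tsum_le_of_sum_le (fun _ ↦ norm_nonneg _) fun F' ↦ ?_
        set Fc : Finset ℂ := F'.image (fun x : {x // x ∉ SZ} ↦ (x.val.val : ℂ)) with hFc
        have hinj : Set.InjOn (fun x : {x // x ∉ SZ} ↦ (x.val.val : ℂ)) F' :=
          (Subtype.val_injective.comp Subtype.val_injective).injOn
        have hsum_eq : ∑ x ∈ F', ‖g (x.val.val : ℂ)‖ = ∑ ρ' ∈ Fc, ‖g ρ'‖ := by
          rw [hFc, Finset.sum_image hinj]
        have hFc' : ∀ ρ' ∈ Fc, ρ' ∈ RHWave0.riemannZetaNontrivialZeros ∧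
            ¬ (‖ρ' - ρ‖ ≤ Real.log T ^ 2 ∧ |ρ'.re - ρ.re| ≤ 1 / (10 * Real.log Y) ∧
              ρ.im ≤ ρ'.im) := by
          intro ρ' h
          obtain ⟨x, _, rfl⟩ := Finset.mem_image.1 h
          refine ⟨x.val.property, fun hc ↦ x.property ?_⟩
          exact Finset.mem_subtype.2 ((hSmem _).2 ⟨x.val.property, hc⟩)
        have hexcl := sum_excluded_zeros_le hCb hCc hC₁ hC₂ hiso hL6 hβ hγ1 hγ2 hu1 huL hA0 Fc hFc'
        calc ∑ x ∈ F', ‖g (x.val.val : ℂ)‖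
            = ∑ ρ' ∈ Fc, ‖g ρ'‖ := hsum_eq
          _ ≤ 4 * Cc * C₂ * Real.exp (4 / 5) * L ^ 5 * Real.exp (L / 2) * Real.exp (-(4 / 5 * L)) +
              4 * Cb * C₁ * L * Real.exp (-(Real.log L ^ 2)) := hexcl
          _ ≤ 1 / (8 * L ^ 100) + 1 / (8 * L ^ 100) := by
              refine add_le_add ?_ ?_
              · have := far_small hKf0 hL1 hLLfar
                rw [hKf] at this
                exact this
              · have := near_small (K := Cb * C₁) (by positivity) hL1 hlogLnear
                calc 4 * Cb * C₁ * L * Real.exp (-(Real.log L ^ 2))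
                    = 4 * (Cb * C₁) * L * Real.exp (-(Real.log L ^ 2)) := by ring
                  _ ≤ _ := this
          _ = 1 / (4 * L ^ 100) := by ring
      -- assemble
      have hmain' : 2 / L ^ 100 ≤ ‖∑ ρ' ∈ S, (riemannZetaZeroOrder ρ' : ℂ) *
          (cexp ((u : ℂ) * (ρ' - ρ)) * mellin (fun x : ℝ ↦ ((w0 x : ℝ) : ℂ)) (ρ' - ρ))‖ := hmain
      rw [← hsplit, hfin]
      have htri := norm_main_le P (∑ ρ' ∈ S, (riemannZetaZeroOrder ρ' : ℂ) *
          (cexp ((u : ℂ) * (ρ' - ρ)) * mellin (fun x : ℝ ↦ ((w0 x : ℝ) : ℂ)) (ρ' - ρ)))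
        (∑' x : {x // x ∉ SZ}, g (x : ℂ)) TS
      have hLpow : (0 : ℝ) < L ^ 100 := by positivity
      have hkey : 1 / L ^ 100 ≤
          2 / L ^ 100 - 1 / (4 * L ^ 100) - 1 / (4 * L ^ 100) - 1 / (4 * L ^ 100) := by
        have : 2 / L ^ 100 - 1 / (4 * L ^ 100) - 1 / (4 * L ^ 100) - 1 / (4 * L ^ 100) =
            (5 / 4) / L ^ 100 := by field_simp; ring
        rw [this]
        exact div_le_div_of_nonneg_right (by norm_num) hLpow.le
      linarith

end MaynardPratt

/-- **Maynard–Pratt 2024, Proposition 16 holds** (discharge of the named fact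
`MaynardPratt2024_prop16`): Proposition 16 from Lemma 11 (`MaynardPratt2024_prop16_of_lemma11`, this
file) and the tree's discharge of Lemma 11
(`Literature.Analysis.Complex.MaynardPratt2024_lemma11_holds`). [cite: MaynardPratt2024, Proposition 16] -/
theorem MaynardPratt2024_prop16_holds : MaynardPratt2024_prop16 :=
  MaynardPratt2024_prop16_of_lemma11 Literature.Analysis.Complex.MaynardPratt2024_lemma11_holds

end Literature.NumberTheory.LFunctions
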